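import Literature.Topology.FourManifolds.MMSWFibreRotation
import Literature.Topology.FourManifolds.MMSWPictureGeneralPosition
import HarnessLib

/-!
# The standard picture of a fibre-rotated model knot

Sibling of `MMSWFibreRotation.lean` (`fibreRot φ : (z, w) ↦ (z, w · φ(z))`),
`MMSWPictureGeneralPosition.lean` (the chart curve of the picture knot is the standard picture,
`stereoCurve_eq_draw`) and `MMSWStripTwist.lean` (the strip twists are fibre rotations), towards
the named fact `Literature.Topology.FourManifolds.MMSW.eventually_approxHasRasmussen`
(Manolescu–Marengon–Sarkar–Willis, arXiv:1910.08195, Thm. 1.4 / Prop. 8.2 (i)) — the first facts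
the read-off of the Gauss diagrams of the twisted pictures `D(0⃗)(fibreRot φ ∘ K)` consumes:
**a fibre rotation by a unit multiplier rotates each point of the planar diagram about the origin
of the picture by `-arg φ(z)` and keeps its height** (`drawC_fibreRot`, `draw_fibreRot_snd`,
`norm_drawC_fibreRot`): for the picture knots `K₃` of `K` and `K₃φ` of `fibreRot φ ∘ K`, the
height curves agree, the complex planar coordinates differ by the factor `conj φ(z(θ))`, the
planar radii agree, and the plane curves agree wherever `φ = 1` along the knot
(`heightCurve_twisted`, `chartC_stereoCurve_twisted`, `norm_chartC_stereoCurve_twisted`,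
`planeCurve_twisted_eq_of_apply_eq_one`).  Everything is proved; no definitions, no named facts.

## References

* C. Manolescu, M. Marengon, S. Sarkar, M. Willis, Duke Math. J. 172 (2023), arXiv:1910.08195,
  §2.1, §2.3 and §8.1. [ManolescuMarengonSarkarWillis2023]
* R. Kirby, *The Topology of 4-Manifolds*, LNM 1374 (1989), Ch. I §2. [Kirby1989]
-/

open scoped Manifold ContDiff Topology ComplexConjugate
open Function Set Complex

noncomputable section

namespace Literature.Topology.FourManifolds

/-- Local notation: `𝔼 n` is the model Euclidean space `EuclideanSpace ℝ (Fin n)`. -/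
local notation "𝔼 " n:arg => EuclideanSpace ℝ (Fin n)

/-- Local notation: `𝕊 n` is the unit sphere in `EuclideanSpace ℝ (Fin (n + 1))`. -/
local notation "𝕊 " n:arg => (Metric.sphere (0 : EuclideanSpace ℝ (Fin (n + 1))) 1)

namespace MMSW

open Literature.AlgebraicTopology.Homotopy.HopfFibration (zC wC ofZW zC_ofZW wC_ofZW ofZW_zC_wC)

variable {r : ℕ}

/-! ## The picture of a fibre rotation -/

/-- **A unit fibre rotation rotates the planar picture point by `conj φ(z)`**:
`drawC (fibreRot φ x) = drawC x · conj φ(z)` when `|φ(z)| = 1`. [folklore] -/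
theorem drawC_fibreRot (φ : ℂ → ℂ) {x : 𝔼 4} (h1 : ‖φ (zC x)‖ = 1) :
    drawC r (fibreRot φ x) = drawC r x * conj (φ (zC x)) := by
  rw [drawC, drawC, zC_fibreRot, wC_fibreRot, norm_mul, h1, mul_one, map_mul]
  ring

/-- A fibre rotation keeps the height of the picture. [folklore] -/
theorem draw_fibreRot_snd (φ : ℂ → ℂ) (x : 𝔼 4) : (draw r (fibreRot φ x)).2 = (draw r x).2 := by
  simp [draw]

/-- A unit fibre rotation keeps the planar radius of the picture. [folklore] -/
theorem norm_drawC_fibreRot (φ : ℂ → ℂ) {x : 𝔼 4} (h1 : ‖φ (zC x)‖ = 1) :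
    ‖drawC r (fibreRot φ x)‖ = ‖drawC r x‖ := by
  rw [drawC_fibreRot φ h1, norm_mul, Complex.norm_conj, h1, mul_one]

/-- Where the multiplier is `1` the picture is unchanged. [folklore] -/
theorem draw_fibreRot_of_apply_eq_one (φ : ℂ → ℂ) {x : 𝔼 4} (h : φ (zC x) = 1) :
    draw r (fibreRot φ x) = draw r x := by
  rw [fibreRot_of_apply_eq_one h]

/-! ## The chart curves of the picture knots of `K` and of `fibreRot φ ∘ K` -/

/-- The complex planar coordinate of the chart curve of a picture knot is `drawC` along the knot.
[folklore] -/
theorem chartC_stereoCurve {K : 𝕊 1 → 𝔼 4} {K₃ : Knot} (hK₃ : ⇑K₃ = finiteApprox r 0 K)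
    (θ : ℝ) : chartC (K₃.stereoCurve θ) = drawC r (K (circlePoint θ)) := by
  rw [stereoCurve_eq_draw hK₃, chartC_draw]

/-- **The height curves of the picture knots of `K` and of `fibreRot φ ∘ K` agree.** [folklore] -/
theorem heightCurve_twisted {K : 𝕊 1 → 𝔼 4} {φ : ℂ → ℂ} {K₃ K₃φ : Knot}
    (hK₃ : ⇑K₃ = finiteApprox r 0 K) (hK₃φ : ⇑K₃φ = finiteApprox r 0 (fibreRot φ ∘ K)) (θ : ℝ) :
    K₃φ.heightCurve θ = K₃.heightCurve θ := by
  rw [Knot.heightCurve_eq_snd_comp, Knot.heightCurve_eq_snd_comp, comp_apply, comp_apply,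
    stereoCurve_eq_draw hK₃, stereoCurve_eq_draw hK₃φ, comp_apply, draw_fibreRot_snd]

/-- **The planar coordinates of the picture knots differ by the factor `conj φ(z(θ))`.**
[folklore] -/
theorem chartC_stereoCurve_twisted {K : 𝕊 1 → 𝔼 4} {φ : ℂ → ℂ} {K₃ K₃φ : Knot}
    (hK₃ : ⇑K₃ = finiteApprox r 0 K) (hK₃φ : ⇑K₃φ = finiteApprox r 0 (fibreRot φ ∘ K))
    (h1 : ∀ t, ‖φ (zC (K t))‖ = 1) (θ : ℝ) :
    chartC (K₃φ.stereoCurve θ) = chartC (K₃.stereoCurve θ) * conj (φ (zC (K (circlePoint θ)))) := by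
  rw [chartC_stereoCurve hK₃φ, chartC_stereoCurve hK₃, comp_apply, drawC_fibreRot φ (h1 _)]

/-- **The planar radii of the two picture knots agree.** [folklore] -/
theorem norm_chartC_stereoCurve_twisted {K : 𝕊 1 → 𝔼 4} {φ : ℂ → ℂ} {K₃ K₃φ : Knot}
    (hK₃ : ⇑K₃ = finiteApprox r 0 K) (hK₃φ : ⇑K₃φ = finiteApprox r 0 (fibreRot φ ∘ K))
    (h1 : ∀ t, ‖φ (zC (K t))‖ = 1) (θ : ℝ) :
    ‖chartC (K₃φ.stereoCurve θ)‖ = ‖chartC (K₃.stereoCurve θ)‖ := by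
  rw [chartC_stereoCurve_twisted hK₃ hK₃φ h1, norm_mul, Complex.norm_conj, h1, mul_one]

/-- The plane curve is determined by the complex planar coordinate. [folklore] -/
theorem planeCurve_eq_of_chartC_eq {K₁ K₂ : Knot} {θ₁ θ₂ : ℝ}
    (h : chartC (K₁.stereoCurve θ₁) = chartC (K₂.stereoCurve θ₂)) :
    K₁.planeCurve θ₁ = K₂.planeCurve θ₂ := by
  have h1 := congrArg Complex.re h
  have h2 := congrArg Complex.im h
  simp only [chartC_re, chartC_im] at h1 h2
  rw [Knot.planeCurve_eq_fst_comp, Knot.planeCurve_eq_fst_comp, comp_apply, comp_apply]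
  exact Prod.ext h1 h2

/-- **Where `φ = 1` along the knot the plane curves of the two picture knots agree.**
[folklore] -/
theorem planeCurve_twisted_eq_of_apply_eq_one {K : 𝕊 1 → 𝔼 4} {φ : ℂ → ℂ} {K₃ K₃φ : Knot}
    (hK₃ : ⇑K₃ = finiteApprox r 0 K) (hK₃φ : ⇑K₃φ = finiteApprox r 0 (fibreRot φ ∘ K)) {θ : ℝ}
    (h : φ (zC (K (circlePoint θ))) = 1) : K₃φ.planeCurve θ = K₃.planeCurve θ := by
  refine planeCurve_eq_of_chartC_eq ?_
  rw [chartC_stereoCurve hK₃φ, chartC_stereoCurve hK₃, comp_apply, fibreRot_of_apply_eq_one h]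

/-- **The planar radius of the picture is `Re z + C_r` along a core-missing model knot** (the
quantity whose windows `MMSWBandGenericity` controls). [folklore] -/
theorem norm_chartC_stereoCurve {K : 𝕊 1 → 𝔼 4} (hK : IsModelKnot r K) (hw : ∀ t, wC (K t) ≠ 0)
    {K₃ : Knot} (hK₃ : ⇑K₃ = finiteApprox r 0 K) (θ : ℝ) :
    ‖chartC (K₃.stereoCurve θ)‖ = (zC (K (circlePoint θ))).re + drawRadius r := by
  rw [chartC_stereoCurve hK₃]
  exact norm_drawC (hw _) (re_zC_add_drawRadius_pos (hK.mem _))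

end MMSW

end Literature.Topology.FourManifolds

end
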